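/-
Copyright (c) 2026 the pub-hodgecm-mathlib formalisation cell (harness21).  Prover seat hodgecm-mathlib-LH7-p10 (g0), req620 Track A «(D-RAM) FOUR-FRAME» squad
(STAGE-1b, row (2) of the piece `f_{T₊}`, the (β₂) road (R-36)∕T20-19 «PURE-CELL LEDGER, RELATIVE SIGNS», the Unr-K sub-lane of type U (census flag #2 of this seat,
15:5xZ); β₂ sub-dealer LH4-p04 (g8) `BETA2-BOARD.v1.1`; the Unr-K twin of ★ p861334 ∕ ★ p861408 (RamK) and ★ p861491 (RamM)), 2026-09-04.
-/
import Summits.HodgeConjecture.HodgeConjecture.Theorems.F0P3cDyRamConeCellLedgerSizes   -- ★ p861408 (this seat): low-cell depth reduction `levelSetDep_eq_levelSet_of_add_le` ∕ `_eq_empty_of_lt_add`; brings ★ p861334, ★ T5a at the frame, ★ DEFS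
import HarnessLib

/-!
# Crux `H413`, line LH4 «(D-RAM) FOUR-FRAME» — STAGE-1b, row (2), the (β₂) road, THE SIZES OF THE PURE-CELL LEDGER, TYPE U ∕ Unr-K SUB-LANE:
# «no diagonal cell; ONE anisotropic cell `a + d = j + 1` with `|G_j| = (q+1)q^{j−1}` lattices; a hyperbolic tower `a + d ≤ j`, `j ≡ a + d (2)` with `(q²−1)q^{j−2−(j−a−d)∕2}`;
#  everything else empty — read off ★ T5a at the frame»

Cell `hodgecm-mathlib` (D-0151), FLOOR 0, crux item H413 = `stmt-HodgeConjecture-24833`, route of record `HCCMUnconditional`; squad F0∕P3c∕LH4; lane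
`--supports stmt-HodgeConjecture-24833 --as helper` (count-neutral; pays NO tier-0 row).  THEOREMS ONLY (no `def`, no instance, no notation, no `sorry`, default heartbeats);
★-only imports; states NO law; (β₂) stays a HYPOTHESIS.

WHY.  Type U (`|α − ρα| = 1`, `M∕E` unramified) splits by ★ `F0P3cDyRamTypeUThirdFieldDichotomy.unrK_iff_not_ramK` into RamK (`|α − Θα| < 1`; ★ T5b tables; the lane of every
U-key on the refuter's disk — ℚ₂(i) c = 5, ℚ₂(√2) c = 5) and Unr-K (`|ρα − Θα| < 1`, `M∕K♮` unramified; ★ T5a tables; e.g. E = ℚ₂(i) with K = ℚ₂(√3)).  In the Unr-K lane the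
diagonal row `a = j` is EMPTY (★ p861334 `ncard_levelSet_diag_unr_eq_zero`): the relative grammar «D₂ = −D₁, S₁ = ∓2D₁, tower doublings» of T20-19 has no subject there, and the
(β₂) cell-sum identity `cellSum_HYP = cellSum_ANISO` (★ p861441's input) runs over a DIFFERENT geography, which THIS FILE pins from ★ T5a at the frame (★
`ncard_levelSet_unr_hyper_of_frame` ∕ `…_aniso_of_frame`, LH4-p08 lineage; third field discharged) — q- and d-general, for tube depths `a ≥ 1`:
* §1 ANISOTROPIC literal: ONE populated row, the HEAD CELL `a + d = j + 1` with `#levelSet(j, a) = |G_j| = (q+1)·q^{j−1}` (`ncard_levelSet_head_unrK_aniso`); every other row with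
  `a ≥ 1` is EMPTY (`ncard_levelSet_unrK_aniso_eq_zero_of_ne`).  (At q = 2: `3·2^{j−1}` lattices × weight `2^a` — an odd multiple of `2^{a+j−1}`.)
* §2 HYPERBOLIC literal: the TOWER `a + d ≤ j`, `j ≡ a + d (2)` with `#levelSet(j, a) = (q²−1)·q^{j−2−(j−a−d)∕2}` (`ncard_levelSet_tower_unrK_hyper`); EMPTY below the tower
  (`j < a + d`, `ncard_levelSet_unrK_hyper_eq_zero_of_lt`) and at the wrong parity (`ncard_levelSet_unrK_hyper_eq_zero_of_odd`).
* §3 the `levelSetDep` forms with the tokens `|μ| = exp(−m)`, `|μ − ρμ| = exp(−jλ)` on the low cells `2a ≤ m`, `j + a ≤ jλ` (★ p861408 §1): `ncard_levelSetDep_head_unrK_aniso`,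
  `ncard_levelSetDep_tower_unrK_hyper`; beyond `jλ` the cells are empty by ★ p861408 `levelSetDep_eq_empty_of_lt_add` (lane-free).
EVIDENCE STATUS (honest): no engine key of the refuter's ledger (cdis1 `BETA2-CELLCHECK.v1`, F0P3-p01 «PURE-CELL LEDGER v1∕v2») lies in this sub-lane as far as this seat can read;
the labels of these cells (pure ∕ balanced ∕ mixed) are UNWITNESSED; only their sizes are typed here.
NOT CLAIMED: anything about labels, signs, maps, or (L-Σ) in this lane.
HONEST LABEL.  Count-neutral index bookkeeping over ★ tables; nothing printed is asserted; no census law is stated; (β₂) the LETTER is UNPROVED; `HC_CM` is proved only modulo the 7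
printed citations (2 remaining named inputs: hLiu418 = `stmt-HodgeConjecture-24832`, h413 = `stmt-HodgeConjecture-24833`) until rung 0 closes.
## References
* [Flicker1998UnitaryFL] Y. Z. Flicker, *Elementary proof of the fundamental lemma for a unitary group*, Canad. J. Math. 50 (1998), Prop. 7 p. 84 (torus-orbit census on the tree).
* [Kottwitz1986BaseChangeUnits] R. E. Kottwitz, *Base change for unit elements of Hecke algebras*, Compositio Math. 60 (1986), §1 pp. 240–241.
* [Serre1979] J.-P. Serre, *Local Fields*, GTM 67 (1979), Ch. V §3 Prop. 5, Cor. 2–3 pp. 84–86.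
* [Jacobowitz1962] R. Jacobowitz, *Hermitian forms over local fields*, Amer. J. Math. 84 (1962), §4.
-/

set_option autoImplicit false

noncomputable section

open scoped Valued WithZero
open WithZero
open scoped Classical
open Summit.HodgeConjecture.HodgeConjecture.Cruxes.H413.F0P3cDyRamToricCensusDefs
open Summit.HodgeConjecture.HodgeConjecture.Cruxes.H413.F0P3cDyRamToricLevelCensusUnrAtThirdField (ncard_levelSet_unr_hyper_of_frame ncard_levelSet_unr_aniso_of_frame)
open Summit.HodgeConjecture.HodgeConjecture.Cruxes.H413.F0P3cDyRamConeCellLedgerSizes (ncard_levelSetDep_eq_of_add_le)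

namespace Summit.HodgeConjecture.HodgeConjecture.Cruxes.H413.F0P3cDyRamConeCellLedgerSizesUnrK

variable {K : Type} [Field K] [Valued K ℤᵐ⁰] {ρ Θ : K →+* K} {α ϖE h : K} {d q : ℕ}

/-! ## §1 The anisotropic literal: one head cell `a + d = j + 1`, everything else empty -/

/-- **THE ANISOTROPIC HEAD CELL, TYPE Unr-K: `a + d = j + 1`, `a ≥ 1` ⇒ `#levelSet(j, a) = (q + 1)·q^{j − 1}` (`= |G_j|`).**  Frame = ★ `ncard_levelSet_unr_aniso_of_frame`'s (one-field
T5a letters `hρρ hvρ hΘΘ hΘρ hvΘ hα1 hα hρϖE hϖE`, `#𝓀[K] = q²`, the Unr-K case-definer `|ρα − Θα| < 1`, the Θ-twist datum `1 ≤ d`, `|ϖE − ΘϖE| = |ϖE|^d`, even orders of the doubly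
fixed `hfixE`; `h` Θ-fixed non-zero ANISOTROPIC). [cite: Flicker1998UnitaryFL, Prop. 7 p. 84] [cite: Serre1979, Ch. V §3 Prop. 5, Cor. 2–3 pp. 84–86] [cite: Jacobowitz1962, §4] -/
theorem ncard_levelSet_head_unrK_aniso [CompleteSpace K] [IsDiscreteValuationRing 𝒪[K]] [Finite 𝓀[K]]
    (hρρ : ∀ x, ρ (ρ x) = x) (hvρ : ∀ x, Valued.v (ρ x) = Valued.v x) (hΘΘ : ∀ x, Θ (Θ x) = x) (hΘρ : ∀ x, Θ (ρ x) = ρ (Θ x))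
    (hvΘ : ∀ x, Valued.v (Θ x) = Valued.v x) (hα1 : Valued.v α ≤ 1) (hα : Valued.v (α - ρ α) = 1)
    (hρϖE : ρ ϖE = ϖE) (hϖE : Valued.v ϖE = exp (-1 : ℤ)) (hq : Nat.card 𝓀[K] = q ^ 2)
    (hτα : Valued.v (ρ α - Θ α) < 1) (hd : 1 ≤ d) (hddE : Valued.v (ϖE - Θ ϖE) = Valued.v ϖE ^ d)
    (hfixE : ∀ z : K, ρ z = z → Θ z = z → z ≠ 0 → ∃ n : ℤ, Valued.v z = exp (2 * n))
    (hΘh : Θ h = h) (hh : h ≠ 0) (haniso : ¬ ∃ x : K, x ≠ 0 ∧ h * Θ x * x + ρ (h * Θ x * x) = 0)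
    {j a : ℕ} (ha : 1 ≤ a) (hhead : a + d = j + 1) :
    (levelSet ρ Θ α ϖE h j a).ncard = (q + 1) * q ^ (j - 1) := by
  rw [ncard_levelSet_unr_aniso_of_frame hρρ hvρ hΘΘ hΘρ hvΘ hα1 hα hρϖE hϖE hq hτα hd hddE hfixE hΘh hh haniso j a,
    if_pos (Or.inl ⟨by omega, hhead⟩), if_neg (by omega)]

/-- **EVERY OTHER ANISOTROPIC ROW IS EMPTY, TYPE Unr-K**: `a ≥ 1`, `a + d ≠ j + 1` ⇒ `#levelSet(j, a) = 0`. [cite: Flicker1998UnitaryFL, Prop. 7 p. 84] [cite: Serre1979, Ch. V §3 Prop. 5, Cor. 2–3 pp. 84–86] -/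
theorem ncard_levelSet_unrK_aniso_eq_zero_of_ne [CompleteSpace K] [IsDiscreteValuationRing 𝒪[K]] [Finite 𝓀[K]]
    (hρρ : ∀ x, ρ (ρ x) = x) (hvρ : ∀ x, Valued.v (ρ x) = Valued.v x) (hΘΘ : ∀ x, Θ (Θ x) = x) (hΘρ : ∀ x, Θ (ρ x) = ρ (Θ x))
    (hvΘ : ∀ x, Valued.v (Θ x) = Valued.v x) (hα1 : Valued.v α ≤ 1) (hα : Valued.v (α - ρ α) = 1)
    (hρϖE : ρ ϖE = ϖE) (hϖE : Valued.v ϖE = exp (-1 : ℤ)) (hq : Nat.card 𝓀[K] = q ^ 2)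
    (hτα : Valued.v (ρ α - Θ α) < 1) (hd : 1 ≤ d) (hddE : Valued.v (ϖE - Θ ϖE) = Valued.v ϖE ^ d)
    (hfixE : ∀ z : K, ρ z = z → Θ z = z → z ≠ 0 → ∃ n : ℤ, Valued.v z = exp (2 * n))
    (hΘh : Θ h = h) (hh : h ≠ 0) (haniso : ¬ ∃ x : K, x ≠ 0 ∧ h * Θ x * x + ρ (h * Θ x * x) = 0)
    {j a : ℕ} (ha : 1 ≤ a) (hne : a + d ≠ j + 1) :
    (levelSet ρ Θ α ϖE h j a).ncard = 0 := by
  rw [ncard_levelSet_unr_aniso_of_frame hρρ hvρ hΘΘ hΘρ hvΘ hα1 hα hρϖE hϖE hq hτα hd hddE hfixE hΘh hh haniso j a, if_neg (by omega)]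

/-! ## §2 The hyperbolic literal: the tower `a + d ≤ j`, `j ≡ a + d (2)`; empty below it and at the wrong parity -/

/-- **THE HYPERBOLIC TOWER, TYPE Unr-K: `a ≥ 1`, `a + d ≤ j`, `(j − a − d)` even ⇒ `#levelSet(j, a) = (q² − 1)·q^{j − 2 − (j − a − d)∕2}`.**  Frame = ★ `ncard_levelSet_unr_hyper_of_frame`'s;
`h` Θ-fixed non-zero ISOTROPIC.  (At q = d = 2, `j = a + c`: `3·2^{a + c∕2 − 1}` lattices × weight `2^a`.) [cite: Flicker1998UnitaryFL, Prop. 7 p. 84] [cite: Serre1979, Ch. V §3 Prop. 5, Cor. 2–3 pp. 84–86]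
[cite: Jacobowitz1962, §4] -/
theorem ncard_levelSet_tower_unrK_hyper [CompleteSpace K] [IsDiscreteValuationRing 𝒪[K]] [Finite 𝓀[K]]
    (hρρ : ∀ x, ρ (ρ x) = x) (hvρ : ∀ x, Valued.v (ρ x) = Valued.v x) (hΘΘ : ∀ x, Θ (Θ x) = x) (hΘρ : ∀ x, Θ (ρ x) = ρ (Θ x))
    (hvΘ : ∀ x, Valued.v (Θ x) = Valued.v x) (hα1 : Valued.v α ≤ 1) (hα : Valued.v (α - ρ α) = 1)
    (hρϖE : ρ ϖE = ϖE) (hϖE : Valued.v ϖE = exp (-1 : ℤ)) (hq : Nat.card 𝓀[K] = q ^ 2)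
    (hτα : Valued.v (ρ α - Θ α) < 1) (hd : 1 ≤ d) (hddE : Valued.v (ϖE - Θ ϖE) = Valued.v ϖE ^ d)
    (hfixE : ∀ z : K, ρ z = z → Θ z = z → z ≠ 0 → ∃ n : ℤ, Valued.v z = exp (2 * n))
    (hΘh : Θ h = h) (hh : h ≠ 0) (hhyper : ∃ x : K, x ≠ 0 ∧ h * Θ x * x + ρ (h * Θ x * x) = 0)
    {j a : ℕ} (ha : 1 ≤ a) (htower : a + d ≤ j) (hpar : (j - a - d) % 2 = 0) :
    (levelSet ρ Θ α ϖE h j a).ncard = (q ^ 2 - 1) * q ^ (j - 2 - (j - a - d) / 2) := by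
  rw [ncard_levelSet_unr_hyper_of_frame hρρ hvρ hΘΘ hΘρ hvΘ hα1 hα hρϖE hϖE hq hτα hd hddE hfixE hΘh hh hhyper j a, if_pos ⟨ha, htower, hpar⟩]

/-- **BELOW THE TOWER THE HYPERBOLIC LITERAL IS EMPTY, TYPE Unr-K**: `a ≥ 1`, `j < a + d` ⇒ `#levelSet(j, a) = 0` (in particular the diagonal `a = j`, ★ p861334 §3).
[cite: Flicker1998UnitaryFL, Prop. 7 p. 84] [cite: Serre1979, Ch. V §3 Prop. 5, Cor. 2–3 pp. 84–86] -/
theorem ncard_levelSet_unrK_hyper_eq_zero_of_lt [CompleteSpace K] [IsDiscreteValuationRing 𝒪[K]] [Finite 𝓀[K]]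
    (hρρ : ∀ x, ρ (ρ x) = x) (hvρ : ∀ x, Valued.v (ρ x) = Valued.v x) (hΘΘ : ∀ x, Θ (Θ x) = x) (hΘρ : ∀ x, Θ (ρ x) = ρ (Θ x))
    (hvΘ : ∀ x, Valued.v (Θ x) = Valued.v x) (hα1 : Valued.v α ≤ 1) (hα : Valued.v (α - ρ α) = 1)
    (hρϖE : ρ ϖE = ϖE) (hϖE : Valued.v ϖE = exp (-1 : ℤ)) (hq : Nat.card 𝓀[K] = q ^ 2)
    (hτα : Valued.v (ρ α - Θ α) < 1) (hd : 1 ≤ d) (hddE : Valued.v (ϖE - Θ ϖE) = Valued.v ϖE ^ d)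
    (hfixE : ∀ z : K, ρ z = z → Θ z = z → z ≠ 0 → ∃ n : ℤ, Valued.v z = exp (2 * n))
    (hΘh : Θ h = h) (hh : h ≠ 0) (hhyper : ∃ x : K, x ≠ 0 ∧ h * Θ x * x + ρ (h * Θ x * x) = 0)
    {j a : ℕ} (ha : 1 ≤ a) (hlt : j < a + d) :
    (levelSet ρ Θ α ϖE h j a).ncard = 0 := by
  rw [ncard_levelSet_unr_hyper_of_frame hρρ hvρ hΘΘ hΘρ hvΘ hα1 hα hρϖE hϖE hq hτα hd hddE hfixE hΘh hh hhyper j a, if_neg (by omega), if_neg (by omega)]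

/-- **AT THE WRONG PARITY THE HYPERBOLIC LITERAL IS EMPTY, TYPE Unr-K**: `a ≥ 1`, `(j − a − d)` odd ⇒ `#levelSet(j, a) = 0`. [cite: Flicker1998UnitaryFL, Prop. 7 p. 84] [cite: Serre1979, Ch. V §3 Prop. 5, Cor. 2–3 pp. 84–86] -/
theorem ncard_levelSet_unrK_hyper_eq_zero_of_odd [CompleteSpace K] [IsDiscreteValuationRing 𝒪[K]] [Finite 𝓀[K]]
    (hρρ : ∀ x, ρ (ρ x) = x) (hvρ : ∀ x, Valued.v (ρ x) = Valued.v x) (hΘΘ : ∀ x, Θ (Θ x) = x) (hΘρ : ∀ x, Θ (ρ x) = ρ (Θ x))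
    (hvΘ : ∀ x, Valued.v (Θ x) = Valued.v x) (hα1 : Valued.v α ≤ 1) (hα : Valued.v (α - ρ α) = 1)
    (hρϖE : ρ ϖE = ϖE) (hϖE : Valued.v ϖE = exp (-1 : ℤ)) (hq : Nat.card 𝓀[K] = q ^ 2)
    (hτα : Valued.v (ρ α - Θ α) < 1) (hd : 1 ≤ d) (hddE : Valued.v (ϖE - Θ ϖE) = Valued.v ϖE ^ d)
    (hfixE : ∀ z : K, ρ z = z → Θ z = z → z ≠ 0 → ∃ n : ℤ, Valued.v z = exp (2 * n))
    (hΘh : Θ h = h) (hh : h ≠ 0) (hhyper : ∃ x : K, x ≠ 0 ∧ h * Θ x * x + ρ (h * Θ x * x) = 0)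
    {j a : ℕ} (ha : 1 ≤ a) (hodd : (j - a - d) % 2 = 1) :
    (levelSet ρ Θ α ϖE h j a).ncard = 0 := by
  rw [ncard_levelSet_unr_hyper_of_frame hρρ hvρ hΘΘ hΘρ hvΘ hα1 hα hρϖE hϖE hq hτα hd hddE hfixE hΘh hh hhyper j a, if_neg (by omega), if_neg (by omega)]

/-! ## §3 The `levelSetDep` forms with the tokens on the low cells (`2a ≤ m`, `j + a ≤ jλ`; ★ p861408 §1) -/

/-- **THE ANISOTROPIC HEAD CELL WITH TOKENS, TYPE Unr-K**: `#levelSetDep(j, a; μ) = (q + 1)·q^{j − 1}` (`a ≥ 1`, `a + d = j + 1`, `2a ≤ m`, `j + a ≤ jλ`).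
[cite: Flicker1998UnitaryFL, Prop. 7 p. 84] [cite: Kottwitz1986BaseChangeUnits, §1 pp. 240–241] -/
theorem ncard_levelSetDep_head_unrK_aniso [CompleteSpace K] [IsDiscreteValuationRing 𝒪[K]] [Finite 𝓀[K]]
    (hρρ : ∀ x, ρ (ρ x) = x) (hvρ : ∀ x, Valued.v (ρ x) = Valued.v x) (hΘΘ : ∀ x, Θ (Θ x) = x) (hΘρ : ∀ x, Θ (ρ x) = ρ (Θ x))
    (hvΘ : ∀ x, Valued.v (Θ x) = Valued.v x) (hα1 : Valued.v α ≤ 1) (hα : Valued.v (α - ρ α) = 1)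
    (hρϖE : ρ ϖE = ϖE) (hϖE : Valued.v ϖE = exp (-1 : ℤ)) (hq : Nat.card 𝓀[K] = q ^ 2)
    (hτα : Valued.v (ρ α - Θ α) < 1) (hd : 1 ≤ d) (hddE : Valued.v (ϖE - Θ ϖE) = Valued.v ϖE ^ d)
    (hfixE : ∀ z : K, ρ z = z → Θ z = z → z ≠ 0 → ∃ n : ℤ, Valued.v z = exp (2 * n))
    (hΘh : Θ h = h) (hh : h ≠ 0) (haniso : ¬ ∃ x : K, x ≠ 0 ∧ h * Θ x * x + ρ (h * Θ x * x) = 0)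
    {μ : K} {m jl : ℕ} (hm : Valued.v μ = exp (-(m : ℤ))) (hjl : Valued.v (μ - ρ μ) = exp (-(jl : ℤ)))
    {j a : ℕ} (ha : 1 ≤ a) (h2a : 2 * a ≤ m) (hja : j + a ≤ jl) (hhead : a + d = j + 1) :
    (levelSetDep ρ Θ α ϖE h j a μ).ncard = (q + 1) * q ^ (j - 1) := by
  rw [ncard_levelSetDep_eq_of_add_le hρρ hvρ hΘΘ hΘρ hvΘ hα1 hα hρϖE hϖE hh hm hjl ha h2a hja]
  exact ncard_levelSet_head_unrK_aniso hρρ hvρ hΘΘ hΘρ hvΘ hα1 hα hρϖE hϖE hq hτα hd hddE hfixE hΘh hh haniso ha hhead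

/-- **THE HYPERBOLIC TOWER WITH TOKENS, TYPE Unr-K**: `#levelSetDep(j, a; μ) = (q² − 1)·q^{j − 2 − (j − a − d)∕2}` (`a ≥ 1`, `a + d ≤ j`, `(j − a − d)` even, `2a ≤ m`, `j + a ≤ jλ`).
[cite: Flicker1998UnitaryFL, Prop. 7 p. 84] [cite: Kottwitz1986BaseChangeUnits, §1 pp. 240–241] -/
theorem ncard_levelSetDep_tower_unrK_hyper [CompleteSpace K] [IsDiscreteValuationRing 𝒪[K]] [Finite 𝓀[K]]
    (hρρ : ∀ x, ρ (ρ x) = x) (hvρ : ∀ x, Valued.v (ρ x) = Valued.v x) (hΘΘ : ∀ x, Θ (Θ x) = x) (hΘρ : ∀ x, Θ (ρ x) = ρ (Θ x))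
    (hvΘ : ∀ x, Valued.v (Θ x) = Valued.v x) (hα1 : Valued.v α ≤ 1) (hα : Valued.v (α - ρ α) = 1)
    (hρϖE : ρ ϖE = ϖE) (hϖE : Valued.v ϖE = exp (-1 : ℤ)) (hq : Nat.card 𝓀[K] = q ^ 2)
    (hτα : Valued.v (ρ α - Θ α) < 1) (hd : 1 ≤ d) (hddE : Valued.v (ϖE - Θ ϖE) = Valued.v ϖE ^ d)
    (hfixE : ∀ z : K, ρ z = z → Θ z = z → z ≠ 0 → ∃ n : ℤ, Valued.v z = exp (2 * n))
    (hΘh : Θ h = h) (hh : h ≠ 0) (hhyper : ∃ x : K, x ≠ 0 ∧ h * Θ x * x + ρ (h * Θ x * x) = 0)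
    {μ : K} {m jl : ℕ} (hm : Valued.v μ = exp (-(m : ℤ))) (hjl : Valued.v (μ - ρ μ) = exp (-(jl : ℤ)))
    {j a : ℕ} (ha : 1 ≤ a) (h2a : 2 * a ≤ m) (hja : j + a ≤ jl) (htower : a + d ≤ j) (hpar : (j - a - d) % 2 = 0) :
    (levelSetDep ρ Θ α ϖE h j a μ).ncard = (q ^ 2 - 1) * q ^ (j - 2 - (j - a - d) / 2) := by
  rw [ncard_levelSetDep_eq_of_add_le hρρ hvρ hΘΘ hΘρ hvΘ hα1 hα hρϖE hϖE hh hm hjl ha h2a hja]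
  exact ncard_levelSet_tower_unrK_hyper hρρ hvρ hΘΘ hΘρ hvΘ hα1 hα hρϖE hϖE hq hτα hd hddE hfixE hΘh hh hhyper ha htower hpar

end Summit.HodgeConjecture.HodgeConjecture.Cruxes.H413.F0P3cDyRamConeCellLedgerSizesUnrK

end
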